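import Summits.MatrixMultiplication.OmegaCensus.STPPProductFamilies
import Summits.MatrixMultiplication.OmegaCensus.STPPPatternMonotonicity
import Literature.Combinatorics.Additive.ArithmeticRemovalProofs
import Mathlib.Algebra.Order.Floor.Defs
import Mathlib.Algebra.Order.Floor.Semiring
import Mathlib.Data.Fin.VecNotation
import Mathlib.Algebra.BigOperators.Fin
import Mathlib.Tactic.FinCases
import Mathlib.Tactic.Positivity
import Mathlib.Tactic.Ring
import Mathlib.Tactic.Linarith

/-!
# ω-census, STPP threshold function: the number of triples of an STPP family is `o(|G|)` — no linear law for `n_k`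

HONEST FRAMING (pub-omega census; verbatim): lottery ticket; floor = certified bounds/negative ranges.
Census STRUCTURE bookkeeping (question Q7 of the cell's `STRUCTURE.md`: the order of growth of the threshold
`n_k` = least order of a finite abelian group hosting `k` simultaneous-TPP triples of 2-subsets), NOT progress on `ω`:
everything below bounds the NUMBER of triples of an STPP family by a vanishing fraction of the group order, which says
nothing about matrix-multiplication exponents.

## What is proved

Let `G` be a finite abelian group and `(Aᵢ, Bᵢ, Cᵢ)_{i<N}` an STPP family in `G` (CKSU 2005 Def. 5.1, tree form
`IsSTPP`) all of whose `3N` sets are nonempty.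

* `isTricoloredSumFree_of_isSTPP` — choosing one point `pᵢ ∈ Aᵢ, qᵢ ∈ Bᵢ, rᵢ ∈ Cᵢ` per triple gives an `N`-element
  tricolored sum-free set `(pᵢ − qᵢ, qᵢ − rᵢ, rᵢ − pᵢ)ᵢ` in `G` (BCCGNSU 2017 Def. 3.1, tree form `IsTricoloredSumFree`):
  the singleton sub-family `({pᵢ}, {qᵢ}, {rᵢ})` is still an STPP family (`isSTPP_mono`) and singleton STPP families ARE
  tricolored sum-free sets (`isSTPP_singleton_iff_isTricoloredSumFree`).  So `N ≤ t⁻¹(|G|)`: the census threshold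
  `t(k)` (least order of an abelian group with a `k`-element tricolored sum-free set, STRUCTURE Q7 / NR142) is a LOWER
  bound for `n_k` — complementing the kernel product law `n_{N·k} ≤ n_N · t(k)` (`STPPTricoloredProduct.lean`).
* `isTricoloredSumFree_card_le_mul` — **tricolored sum-free sets are sparse in every finite abelian group**: for every
  `ε > 0` there is `N₀` such that every tricolored sum-free set in a finite abelian group `G` with `|G| ≥ N₀` has at most
  `ε |G|` elements.  Proof (the "relatively trivial" direction of the matching/removal correspondence, J. Aaronson,
  arXiv:1612.04172, §1 Remark): the three colour classes `X = {xᵢ}, Y = {yᵢ}, Z = {zᵢ}` span exactly the `n ≤ |G|`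
  zero-sum triples `(xᵢ, yᵢ, zᵢ)`, which is `≤ δ |G|²` once `|G| ≥ 1/δ`; Green's arithmetic removal lemma (Green 2005
  Thm. 1.5 — the tree's `Green2005_1_5_holds`, PROVED in `ArithmeticRemovalProofs.lean` via Král'–Serra–Vena) deletes
  `≤ (ε/3)|G|` elements from each class killing all zero-sum triples; but the `n` matched triples are pairwise disjoint in
  every coordinate, so each deletion kills at most one of them: `n ≤ 3 · (ε/3)|G|`.
* `isSTPP_card_le_mul` — hence **the number of triples of an STPP family with nonempty parts is `o(|G|)`**, uniformly
  over all finite abelian groups (the count form of K. Pratt's Cor. 2.9, arXiv:2309.03878, whose printed packing-sum form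
  is false — tree `not_pratt2024_cor210` — while this count form and the sum-of-minima form survive).
* `exists_lt_card_of_isSTPP` / `exists_lt_card_of_isSTPP_222pow` / `exists_lt_card_of_isTricoloredSumFree` — the
  census reading: **for every constant `c` there is `K` such that for all `k ≥ K`, every finite abelian group hosting an
  STPP family of `k` triples with nonempty parts (in particular the pattern `(2,2,2)^k`, or a `k`-element tricolored
  sum-free set) has order `> c·k`.**  So `n_k / k → ∞` and `t(k) / k → ∞`: the threshold function of STRUCTURE Q7 admits
  NO linear law `n_k ≤ C·k` (the question left open there, 2026-08-23T11:31Z: "is `n_k = O(k)`?" — answer: no), while the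
  tree's Behrend route gives `n_k ≤ k^{1+o(1)}` (`STPPThreeAPFree.lean`) and packing gives `n_k ≥ 8k − 4`
  (`card_ge_of_isSTPP_222pow`).  The rate is ineffective here (Green's removal lemma through Szemerédi regularity);
  no quantitative claim is made.

References: B. Green, *A Szemerédi-type regularity lemma in abelian groups, with applications*, GAFA 15 (2005), Thm. 1.5;
J. Aaronson, *A connection between matchings and removal in abelian groups*, arXiv:1612.04172 (2016), §1 (Remark);
J. Blasiak, T. Church, H. Cohn, J. A. Grochow, E. Naslund, W. F. Sawin, C. Umans, Discrete Analysis 2017:3, Def. 3.1;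
H. Cohn, R. Kleinberg, B. Szegedy, C. Umans, FOCS 2005, Def. 5.1; K. Pratt, ITCS 2024 (arXiv:2309.03878), Cor. 2.9.
Seat pub-omega-stpp-3 (gen 9), 2026-08-24.
-/

open Literature.Computability.AlgebraicComplexity Literature.Combinatorics.Additive Finset

namespace Summit.MatrixMultiplication.OmegaCensus

/-! ## STPP families contain tricolored sum-free sets of the same size -/

section Reps

variable {H : Type*} [AddCommGroup H] {N : ℕ} {A B C : Fin N → Finset H}

/-- **Representatives of an STPP family form a tricolored sum-free set.** If `(Aᵢ, Bᵢ, Cᵢ)_{i<N}` is an STPP family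
(CKSU Def. 5.1) and `pᵢ ∈ Aᵢ`, `qᵢ ∈ Bᵢ`, `rᵢ ∈ Cᵢ`, then `(pᵢ − qᵢ, qᵢ − rᵢ, rᵢ − pᵢ)ᵢ` is a tricolored sum-free set
(BCCGNSU Def. 3.1): the singleton sub-family is STPP (`isSTPP_mono`) and `isSTPP_singleton_iff_isTricoloredSumFree`.
[cite: CohnKleinbergSzegedyUmans2005, Def. 5.1] [cite: BlasiakChurchCohnGrochowNaslundSawinUmans2017, Def. 3.1] -/
theorem isTricoloredSumFree_of_isSTPP (hS : IsSTPP A B C) {p q r : Fin N → H}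
    (hp : ∀ i, p i ∈ A i) (hq : ∀ i, q i ∈ B i) (hr : ∀ i, r i ∈ C i) :
    IsTricoloredSumFree (fun i => p i - q i) (fun i => q i - r i) (fun i => r i - p i) :=
  (isSTPP_singleton_iff_isTricoloredSumFree p q r).1
    (isSTPP_mono hS (fun i => singleton_subset_iff.2 (hp i)) (fun i => singleton_subset_iff.2 (hq i))
      (fun i => singleton_subset_iff.2 (hr i)))

/-- Existential form: an STPP family of `N` triples with all parts nonempty yields an `N`-element tricolored sum-free
set in the same group. [cite: CohnKleinbergSzegedyUmans2005, Def. 5.1]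
[cite: BlasiakChurchCohnGrochowNaslundSawinUmans2017, Def. 3.1] -/
theorem exists_isTricoloredSumFree_of_isSTPP (hS : IsSTPP A B C)
    (hne : ∀ i, (A i).Nonempty ∧ (B i).Nonempty ∧ (C i).Nonempty) :
    ∃ s t u : Fin N → H, IsTricoloredSumFree s t u := by
  choose p hp using fun i => (hne i).1
  choose q hq using fun i => (hne i).2.1
  choose r hr using fun i => (hne i).2.2
  exact ⟨_, _, _, isTricoloredSumFree_of_isSTPP hS hp hq hr⟩

/-- A `k`-element tricolored sum-free set lives in a group with at least `k` elements (its first colour class is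
injective). [cite: BlasiakChurchCohnGrochowNaslundSawinUmans2017, Def. 3.1] -/
theorem le_card_of_isTricoloredSumFree {G : Type*} [AddCommGroup G] [Fintype G] {k : ℕ} {s t u : Fin k → G}
    (hT : IsTricoloredSumFree s t u) : k ≤ Fintype.card G := by
  simpa using Fintype.card_le_of_injective s hT.injective_left

end Reps

/-! ## Tricolored sum-free sets are sparse (Green's removal lemma) -/

/-- **Tricolored sum-free sets have `o(|G|)` elements, in every finite abelian group.** For every `ε > 0` there is
`N₀` such that for every finite abelian group `G` with `|G| ≥ N₀`, every tricolored sum-free set `(sᵢ, tᵢ, uᵢ)_{i<n}` in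
`G` has `n ≤ ε |G|`.  Proof: Green's arithmetic removal lemma (tree `Green2005_1_5_holds`, `k = 3`, tolerance `ε/3`)
applied to the colour classes `X = s(univ), Y = t(univ), Z = u(univ)`, whose zero-sum triples are exactly the `n ≤ |G|`
matched ones (`≤ δ|G|²` as soon as `|G| ≥ 1/δ`); the removed `≤ (ε/3)|G|` elements per class must hit every matched
triple, and the matched triples are disjoint in each coordinate.  (J. Aaronson, arXiv:1612.04172, §1, Remark: "a
converse of sorts … that bounds on removal imply similar bounds on the maximal size of an additive matching, is
relatively trivial".)  Ineffective (regularity-lemma constants). [cite: Green2005, Thm. 1.5]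
[cite: BlasiakChurchCohnGrochowNaslundSawinUmans2017, Def. 3.1] -/
theorem isTricoloredSumFree_card_le_mul (ε : ℝ) (hε : 0 < ε) :
    ∃ N₀ : ℕ, ∀ (G : Type) [AddCommGroup G] [Fintype G] [DecidableEq G], N₀ ≤ Fintype.card G →
      ∀ (n : ℕ) (s t u : Fin n → G), IsTricoloredSumFree s t u → (n : ℝ) ≤ ε * Fintype.card G := by
  obtain ⟨δ, hδ, hrem⟩ := Green2005_1_5_holds 3 le_rfl (ε / 3) (by positivity)
  refine ⟨⌈1 / δ⌉₊, fun G _ _ _ hG n s t u hT => ?_⟩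
  -- the three colour classes as a `Fin 3`-indexed family
  set A : Fin 3 → Finset G := ![univ.image s, univ.image t, univ.image u] with hA
  have hA0 : A 0 = univ.image s := by simp [hA]
  have hA1 : A 1 = univ.image t := by simp [hA]
  have hA2 : A 2 = univ.image u := by simp [hA]
  -- `|G| ≥ 1/δ`
  have hNδ : (1 : ℝ) ≤ δ * Fintype.card G := by
    have h1 : (1 / δ : ℝ) ≤ Fintype.card G := (Nat.le_ceil _).trans (by exact_mod_cast hG)
    rw [div_le_iff₀ hδ] at h1
    linarith [mul_comm δ (Fintype.card G : ℝ)]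
  -- every zero-sum triple of `X × Y × Z` is a matched triple
  have hsol : ∀ a ∈ (Fintype.piFinset A).filter (fun a => ∑ i, a i = 0),
      ∃ m : Fin n, a 0 = s m ∧ a 1 = t m ∧ a 2 = u m := by
    intro a ha
    rw [mem_filter, Fintype.mem_piFinset] at ha
    obtain ⟨hmem, hsum⟩ := ha
    have h0 := hmem 0
    have h1 := hmem 1
    have h2 := hmem 2
    rw [hA0] at h0
    rw [hA1] at h1
    rw [hA2] at h2
    simp only [mem_image, mem_univ, true_and] at h0 h1 h2
    obtain ⟨i, hi⟩ := h0
    obtain ⟨j, hj⟩ := h1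
    obtain ⟨l, hl⟩ := h2
    rw [Fin.sum_univ_three, ← hi, ← hj, ← hl] at hsum
    obtain ⟨rfl, rfl⟩ := (hT i j l).1 hsum
    exact ⟨i, hi.symm, hj.symm, hl.symm⟩
  -- hence there are at most `|G|` of them
  have hcardS : ((Fintype.piFinset A).filter (fun a => ∑ i, a i = 0)).card ≤ Fintype.card G := by
    rw [← Finset.card_univ (α := G)]
    refine card_le_card_of_injOn (fun a => a 0) (fun a _ => mem_coe.2 (mem_univ _)) ?_
    intro a ha b hb hab
    obtain ⟨m, ha0, ha1, ha2⟩ := hsol a (mem_coe.1 ha)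
    obtain ⟨m', hb0, hb1, hb2⟩ := hsol b (mem_coe.1 hb)
    have hmm : m = m' := hT.injective_left (by rw [← ha0, ← hb0]; exact hab)
    subst hmm
    funext x
    fin_cases x
    · exact ha0.trans hb0.symm
    · exact ha1.trans hb1.symm
    · exact ha2.trans hb2.symm
  have hhyp : ((((Fintype.piFinset A).filter (fun a => ∑ i, a i = 0)).card : ℕ) : ℝ) ≤
      δ * (Fintype.card G : ℝ) ^ (3 - 1) := by
    have h1 : ((((Fintype.piFinset A).filter (fun a => ∑ i, a i = 0)).card : ℕ) : ℝ) ≤ Fintype.card G := by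
      exact_mod_cast hcardS
    have h2 : (Fintype.card G : ℝ) ≤ δ * (Fintype.card G : ℝ) ^ (3 - 1) := by
      have hc : (0 : ℝ) ≤ Fintype.card G := by positivity
      calc (Fintype.card G : ℝ) = 1 * Fintype.card G := (one_mul _).symm
        _ ≤ (δ * Fintype.card G) * Fintype.card G := mul_le_mul_of_nonneg_right hNδ hc
        _ = δ * (Fintype.card G : ℝ) ^ (3 - 1) := by norm_num; ring
    exact h1.trans h2
  obtain ⟨A', hsub, hsmall, hfree⟩ := hrem G A hhyp
  -- each matched triple loses at least one of its three points
  have hcover : ∀ m : Fin n, ∃ i : Fin 3, (![s m, t m, u m] : Fin 3 → G) i ∈ A i \ A' i := by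
    intro m
    by_contra hcon
    push Not at hcon
    have hmem : (![s m, t m, u m] : Fin 3 → G) ∈ Fintype.piFinset A' := by
      rw [Fintype.mem_piFinset]
      intro i
      have hAi : (![s m, t m, u m] : Fin 3 → G) i ∈ A i := by
        fin_cases i
        · simp [hA0]
        · simp [hA1]
        · simp [hA2]
      have hi := hcon i
      rw [mem_sdiff, not_and, not_not] at hi
      exact hi hAi
    have hsum : ∑ i, (![s m, t m, u m] : Fin 3 → G) i = 0 := by
      rw [Fin.sum_univ_three]
      simpa using hT.sum_eq_zero m
    exact hfree _ hmem hsum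
  choose g hg using hcover
  -- fibre count: the triples losing their `i`-th point inject into `A i \ A' i`
  have hfib : ∀ i : Fin 3, ((univ : Finset (Fin n)).filter (fun m => g m = i)).card ≤ (A i \ A' i).card := by
    intro i
    refine card_le_card_of_injOn (fun m => (![s m, t m, u m] : Fin 3 → G) i) ?_ ?_
    · intro m hm
      rw [mem_coe, mem_filter] at hm
      rw [← hm.2]
      exact hg m
    · intro m _ m' _ hmm'
      fin_cases i
      · exact hT.injective_left (by simpa using hmm')
      · exact hT.injective_middle (by simpa using hmm')
      · exact hT.injective_right (by simpa using hmm')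
  have hn : n = ∑ i : Fin 3, ((univ : Finset (Fin n)).filter (fun m => g m = i)).card := by
    rw [← card_eq_sum_card_fiberwise (fun m _ => mem_coe.2 (mem_univ (g m))), card_univ, Fintype.card_fin]
  have h3 : (n : ℝ) ≤ ∑ i : Fin 3, ((A i \ A' i).card : ℝ) := by
    rw [hn]
    push_cast
    exact sum_le_sum fun i _ => by exact_mod_cast hfib i
  calc (n : ℝ) ≤ ∑ i : Fin 3, ((A i \ A' i).card : ℝ) := h3
    _ ≤ ∑ _i : Fin 3, ε / 3 * (Fintype.card G : ℝ) := sum_le_sum fun i _ => hsmall i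
    _ = ε * Fintype.card G := by
      simp only [sum_const, card_univ, Fintype.card_fin, nsmul_eq_mul]
      push_cast
      ring

/-! ## STPP families have `o(|G|)` triples -/

/-- **The number of triples of an STPP family is `o(|G|)`.** For every `ε > 0` there is `N₀` such that for every finite
abelian group `G` with `|G| ≥ N₀` and every STPP family `(Aᵢ, Bᵢ, Cᵢ)_{i<N}` in `G` (CKSU Def. 5.1) with all parts
nonempty, `N ≤ ε |G|` (representatives give an `N`-element tricolored sum-free set, which is sparse by
`isTricoloredSumFree_card_le_mul`).  Count form of Pratt 2024 Cor. 2.9; the nonemptiness proviso is necessary (empty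
parts make Def. 5.1 vacuous). [cite: CohnKleinbergSzegedyUmans2005, Def. 5.1] [cite: Green2005, Thm. 1.5] -/
theorem isSTPP_card_le_mul (ε : ℝ) (hε : 0 < ε) :
    ∃ N₀ : ℕ, ∀ (G : Type) [AddCommGroup G] [Fintype G] [DecidableEq G], N₀ ≤ Fintype.card G →
      ∀ (N : ℕ) (A B C : Fin N → Finset G), IsSTPP A B C →
        (∀ i, (A i).Nonempty ∧ (B i).Nonempty ∧ (C i).Nonempty) → (N : ℝ) ≤ ε * Fintype.card G := by
  obtain ⟨N₀, h⟩ := isTricoloredSumFree_card_le_mul ε hε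
  refine ⟨N₀, fun G _ _ _ hG N A B C hS hne => ?_⟩
  obtain ⟨s, t, u, hT⟩ := exists_isTricoloredSumFree_of_isSTPP hS hne
  exact h G hG N s t u hT

/-! ## Census reading: no linear law -/

/-- **`t(k)/k → ∞`**: for every `c` there is `K` such that for all `k ≥ K`, a finite abelian group with a `k`-element
tricolored sum-free set has more than `c·k` elements (with `ε = 1/(c+1)` in `isTricoloredSumFree_card_le_mul`; the
group is large because it has at least `k` elements). [cite: Green2005, Thm. 1.5]
[cite: BlasiakChurchCohnGrochowNaslundSawinUmans2017, Def. 3.1] -/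
theorem exists_lt_card_of_isTricoloredSumFree (c : ℕ) :
    ∃ K : ℕ, ∀ k : ℕ, K ≤ k → ∀ (G : Type) [AddCommGroup G] [Fintype G] (s t u : Fin k → G),
      IsTricoloredSumFree s t u → c * k < Fintype.card G := by
  obtain ⟨N₀, h⟩ := isTricoloredSumFree_card_le_mul (1 / ((c : ℝ) + 1)) (by positivity)
  refine ⟨max N₀ 1, fun k hk G _ _ s t u hT => ?_⟩
  classical
  have hkG : k ≤ Fintype.card G := le_card_of_isTricoloredSumFree hT
  have hN₀ : N₀ ≤ Fintype.card G := ((le_max_left _ _).trans hk).trans hkG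
  have hk1 : 1 ≤ k := (le_max_right _ _).trans hk
  have hreal : (k : ℝ) ≤ 1 / ((c : ℝ) + 1) * Fintype.card G := h G hN₀ k s t u hT
  have hc1 : (0 : ℝ) < (c : ℝ) + 1 := by positivity
  have hmul : ((c : ℝ) + 1) * k ≤ Fintype.card G := by
    have := mul_le_mul_of_nonneg_left hreal hc1.le
    rwa [← mul_assoc, mul_one_div_cancel hc1.ne', one_mul] at this
  have hnat : (c + 1) * k ≤ Fintype.card G := by exact_mod_cast hmul
  calc c * k < c * k + k := Nat.lt_add_of_pos_right (by omega)
    _ = (c + 1) * k := by ring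
    _ ≤ Fintype.card G := hnat

/-- **`n_k/k → ∞` for STPP families with nonempty parts**: for every `c` there is `K` such that for all `k ≥ K`, every
finite abelian group hosting an STPP family of `k` triples with all parts nonempty has more than `c·k` elements.
[cite: CohnKleinbergSzegedyUmans2005, Def. 5.1] [cite: Green2005, Thm. 1.5] -/
theorem exists_lt_card_of_isSTPP (c : ℕ) :
    ∃ K : ℕ, ∀ k : ℕ, K ≤ k → ∀ (G : Type) [AddCommGroup G] [Fintype G] (A B C : Fin k → Finset G),
      IsSTPP A B C → (∀ i, (A i).Nonempty ∧ (B i).Nonempty ∧ (C i).Nonempty) → c * k < Fintype.card G := by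
  obtain ⟨K, h⟩ := exists_lt_card_of_isTricoloredSumFree c
  refine ⟨K, fun k hk G _ _ A B C hS hne => ?_⟩
  obtain ⟨s, t, u, hT⟩ := exists_isTricoloredSumFree_of_isSTPP hS hne
  exact h k hk G s t u hT

/-- **No linear law for the `(2,2,2)^k` threshold (STRUCTURE Q7).** For every `c` there is `K` such that for all
`k ≥ K`, every finite abelian group hosting `k` simultaneous-TPP triples of 2-subsets has order `> c·k`; i.e. the
census threshold `n_k` (least such order) is not `O(k)` — against the kernel brackets `8k − 4 ≤ n_k`
(`card_ge_of_isSTPP_222pow`) and `n_k ≤ k^{1+o(1)}` (`STPPThreeAPFree.lean`).  Ineffective.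
[cite: CohnKleinbergSzegedyUmans2005, Def. 5.1] [cite: Green2005, Thm. 1.5] -/
theorem exists_lt_card_of_isSTPP_222pow (c : ℕ) :
    ∃ K : ℕ, ∀ k : ℕ, K ≤ k → ∀ (G : Type) [AddCommGroup G] [Fintype G] (A B C : Fin k → Finset G),
      IsSTPP A B C → (∀ i, (A i).card = 2 ∧ (B i).card = 2 ∧ (C i).card = 2) → c * k < Fintype.card G := by
  obtain ⟨K, h⟩ := exists_lt_card_of_isSTPP c
  refine ⟨K, fun k hk G _ _ A B C hS hc => h k hk G A B C hS fun i => ⟨?_, ?_, ?_⟩⟩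
  · exact card_pos.1 (by rw [(hc i).1]; norm_num)
  · exact card_pos.1 (by rw [(hc i).2.1]; norm_num)
  · exact card_pos.1 (by rw [(hc i).2.2]; norm_num)

end Summit.MatrixMultiplication.OmegaCensus
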